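import Literature.MathematicalPhysics.KineticTheory.DiPernaLionsVelocityAverages
import Literature.MathematicalPhysics.KineticTheory.DiPernaLionsEntropyDissipation
import Literature.Analysis.FluidPDE.CollisionWeakForm
import HarnessLib

/-!
# The normalised tensor products of the DiPerna–Lions approximate solutions (CIP Step 14)

Topic: MathematicalPhysics / KineticTheory. Third layer of the proof of the named fact (E49)
`Kinetic.diPernaLions_limit_gain_le_loss` (`DiPernaLionsMildLimit`): the bookkeeping for the last
paragraph of Cercignani–Illner–Pulvirenti 1994 §5.3 Step 14 (p. 160), where the entropy
dissipation of the weak limit is bounded through the weak limits of the normalised products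
`fⁿ fⁿ_* /(1 + δ ∫ fⁿ dξ)` and `fⁿ' fⁿ_*' /(1 + δ ∫ fⁿ dξ)` on `(0,T) × ℝ^d_x × ℝ^d_ξ × ℝ^d_* × S^{d-1}`
("from the proof of Lemma 5.3.11"). Everything here is **proved**; theorems and definitions with
bodies only.

* The carrier `((0,T) × E_x) × ((E_ξ × E_*) × S^{d-1})` with the product Lebesgue–sphere measure
  (`Kinetic.dissPhaseMeasure`), its regrouping `((t,x,ξ), (ξ_*,ω)) ↦ ((t,x), ((ξ,ξ_*),ω))`
  (`Kinetic.dissPhaseEquiv`, measure preserving from `slabMeasure ⊗ (dξ_* dω)`: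
  `measurePreserving_dissPhaseEquiv`) and the collision involution
  `((t,x),((ξ,ξ_*),ω)) ↦ ((t,x),((ξ_*',ξ'),ω))` (`Kinetic.phaseCollideEquiv`, measure preserving:
  `measurePreserving_phaseCollideEquiv`).
* The normalised tensor product `F_κ(u) = u(ξ) u(ξ_*)/(1 + κ ∫ u dξ)` of a phase-space density
  (`Kinetic.tensorNorm`, with the velocity mass `Kinetic.velMass`) and its post-collisional version
  `G_κ(u) = F_κ(u) ∘ (collision involution)` (`Kinetic.tensorNormColl`); the cut-off weights
  `w = min(B, M) · ρ(t,x) · 1_{|ξ|²+|ξ_*|² ≤ R²}` (`Kinetic.dissWeight`, `Kinetic.velBall`).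
* **Fubini** (`integral_dissWeight_tensorNorm_mul`): testing `w F_κ(u)` against a bounded `θ` is
  testing `u` on the slab `(0,T) × E × E` against the bounded velocity average
  `Ψ(t,x,ξ) = ρ (1 + κ ∫u dξ)⁻¹ ∫∫ 1 min(B,M) θ u(ξ_*) dξ_* dω` (`Kinetic.dissTestAverage`); and
  **symmetry** (`integral_dissWeight_tensorNormColl_mul`): testing `w G_κ(u)` against `θ` is
  testing `w F_κ(u)` against `θ ∘ (collision involution)`, for collision-invariant kernels.

## References

* C. Cercignani, R. Illner, M. Pulvirenti, *The Mathematical Theory of Dilute Gases*, Springer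
  (1994), §5.3 Step 14, last paragraph (p. 160); §3.1 (unit Jacobian of the collision map, p. 35).
* P.-L. Lions, *Global solutions of kinetic models and related problems*, LNM 1551 (1993),
  Thm III.4 (p. 57).
-/

open MeasureTheory Metric Real Set Filter Topology
open scoped InnerProductSpace ENNReal

noncomputable section

namespace Literature.MathematicalPhysics.KineticTheory

open Literature.Analysis.FluidPDE Literature.Analysis.FunctionSpaces

section Carrier

variable {E : Type*} [NormedAddCommGroup E] [InnerProductSpace ℝ E] [FiniteDimensional ℝ E]
  [MeasurableSpace E] [BorelSpace E]

/-! ## The carrier `((0,T) × E) × ((E × E) × S^{d-1})` -/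

variable (E) in
/-- The measure `dt dx ⊗ ((dξ dξ_*) ⊗ dω)` on `((0,T) × E) × ((E × E) × S^{d-1})`, the carrier of the
normalised tensor products of CIP 1994 Step 14 (p. 160: "in `L¹((0,T) × ℝ^d_x × ℝ^d_η × S^{d-1})`",
with both velocity variables). [cite: CIPDiluteGases1994, §5.3 Step 14 (p. 160)] -/
def dissPhaseMeasure (T : ℝ) : Measure ((ℝ × E) × ((E × E) × sphere (0 : E) 1)) :=
  (baseSlabMeasure E T).prod (((volume : Measure E).prod volume).prod (sphereMeasure (E := E)))

/-- The regrouping `((t,x,ξ), (ξ_*, ω)) ↦ ((t,x), ((ξ, ξ_*), ω))` between "slab point with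
collision parameters" and the carrier, as a measurable equivalence. [folklore] -/
def dissPhaseEquiv :
    (ℝ × E × E) × (E × sphere (0 : E) 1) ≃ᵐ (ℝ × E) × ((E × E) × sphere (0 : E) 1) :=
  ((slabAssoc (E := E)).symm.prodCongr (MeasurableEquiv.refl _)).trans
    (MeasurableEquiv.prodAssoc.trans
      ((MeasurableEquiv.refl _).prodCongr MeasurableEquiv.prodAssoc.symm))

omit [InnerProductSpace ℝ E] [FiniteDimensional ℝ E] [BorelSpace E] in
/-- Unfolding of `dissPhaseEquiv`. [folklore] -/
@[simp]
theorem dissPhaseEquiv_apply (y : (ℝ × E × E) × (E × sphere (0 : E) 1)) :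
    dissPhaseEquiv y = ((y.1.1, y.1.2.1), ((y.1.2.2, y.2.1), y.2.2)) := rfl

/-- `dissPhaseEquiv` carries `slabMeasure ⊗ (dξ_* dω)` to the carrier measure. [folklore] -/
theorem measurePreserving_dissPhaseEquiv (T : ℝ) :
    MeasurePreserving (dissPhaseEquiv (E := E))
      ((slabMeasure E T).prod ((volume : Measure E).prod (sphereMeasure (E := E)))) (dissPhaseMeasure E T) := by
  haveI := isFiniteMeasure_sphereMeasure (E := E)
  haveI : SigmaFinite (baseSlabMeasure E T) := by rw [baseSlabMeasure_def]; infer_instance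
  haveI : SigmaFinite (slabMeasure E T) := by rw [slabMeasure_def]; infer_instance
  have h1 : MeasurePreserving ((slabAssoc (E := E)).symm.prodCongr (MeasurableEquiv.refl _))
      ((slabMeasure E T).prod ((volume : Measure E).prod (sphereMeasure (E := E))))
      (((baseSlabMeasure E T).prod volume).prod ((volume : Measure E).prod (sphereMeasure (E := E)))) :=
    ((measurePreserving_slabAssoc (E := E) T).symm _).prod (MeasurePreserving.id _)
  have h2 : MeasurePreserving (MeasurableEquiv.prodAssoc :
        ((ℝ × E) × E) × (E × sphere (0 : E) 1) ≃ᵐ (ℝ × E) × (E × (E × sphere (0 : E) 1)))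
      (((baseSlabMeasure E T).prod volume).prod ((volume : Measure E).prod (sphereMeasure (E := E))))
      ((baseSlabMeasure E T).prod ((volume : Measure E).prod
        ((volume : Measure E).prod (sphereMeasure (E := E))))) :=
    measurePreserving_prodAssoc _ _ _
  have h3 : MeasurePreserving ((MeasurableEquiv.refl (ℝ × E)).prodCongr
        (MeasurableEquiv.prodAssoc : (E × E) × sphere (0 : E) 1 ≃ᵐ E × (E × sphere (0 : E) 1)).symm)
      ((baseSlabMeasure E T).prod ((volume : Measure E).prod
        ((volume : Measure E).prod (sphereMeasure (E := E))))) (dissPhaseMeasure E T) :=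
    (MeasurePreserving.id _).prod ((measurePreserving_prodAssoc _ _ _).symm _)
  exact h3.comp (h2.comp h1)

/-- The collision involution `((t,x),((ξ,ξ_*),ω)) ↦ ((t,x),((ξ_*',ξ'),ω))` of the carrier
(`(ξ',ξ_*') = collide ω (ξ,ξ_*)`), as a measurable equivalence. [folklore] -/
def phaseCollideEquiv :
    (ℝ × E) × ((E × E) × sphere (0 : E) 1) ≃ᵐ (ℝ × E) × ((E × E) × sphere (0 : E) 1) where
  toFun y := (y.1, ((collide y.2.2 y.2.1).swap, y.2.2))
  invFun y := (y.1, ((collide y.2.2 y.2.1).swap, y.2.2))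
  left_inv y := by
    obtain ⟨p, q⟩ := y
    simp only [Prod.mk.injEq, true_and]
    exact collideSwap_prod_involutive q
  right_inv y := by
    obtain ⟨p, q⟩ := y
    simp only [Prod.mk.injEq, true_and]
    exact collideSwap_prod_involutive q
  measurable_toFun :=
    measurable_fst.prodMk (((continuous_collide_uncurry.snd.prodMk
      continuous_collide_uncurry.fst).prodMk continuous_snd).measurable.comp measurable_snd)
  measurable_invFun :=
    measurable_fst.prodMk (((continuous_collide_uncurry.snd.prodMk
      continuous_collide_uncurry.fst).prodMk continuous_snd).measurable.comp measurable_snd)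

/-- Unfolding of `phaseCollideEquiv`. [folklore] -/
@[simp]
theorem phaseCollideEquiv_apply (y : (ℝ × E) × ((E × E) × sphere (0 : E) 1)) :
    phaseCollideEquiv y = (y.1, ((collide y.2.2 y.2.1).swap, y.2.2)) := rfl

/-- The collision involution is an involution. [folklore] -/
theorem phaseCollideEquiv_phaseCollideEquiv (y : (ℝ × E) × ((E × E) × sphere (0 : E) 1)) :
    phaseCollideEquiv (phaseCollideEquiv y) = y :=
  (phaseCollideEquiv (E := E)).left_inv y

/-- The collision involution preserves the carrier measure (unit Jacobian of the collision map,
CIP 1994 §3.1 p. 35, through `measurePreserving_collideSwap_prod`). [cite: CIPDiluteGases1994, §3.1 p. 35] -/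
theorem measurePreserving_phaseCollideEquiv (T : ℝ) :
    MeasurePreserving (phaseCollideEquiv (E := E)) (dissPhaseMeasure E T) (dissPhaseMeasure E T) := by
  haveI := isFiniteMeasure_sphereMeasure (E := E)
  haveI : SigmaFinite (baseSlabMeasure E T) := by rw [baseSlabMeasure_def]; infer_instance
  exact (MeasurePreserving.id (baseSlabMeasure E T)).prod measurePreserving_collideSwap_prod

/-! ## Normalised tensor products and cut-off weights -/

/-- The velocity mass `∫ u(t, x, ξ) dξ` of a phase-space density (Bochner integral, junk `0`).
[folklore] -/
def velMass (u : ℝ × E × E → ℝ) (p : ℝ × E) : ℝ := ∫ ξ, u (p.1, p.2, ξ)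

/-- The normalised tensor product `F_κ(u)((t,x),((ξ,ξ_*),ω)) = u(t,x,ξ) u(t,x,ξ_*) / (1 + κ ∫ u dξ)`
of CIP 1994 Step 14 (p. 160: `fⁿ fⁿ_* / (1 + δ ∫ fⁿ dξ)`). [cite: CIPDiluteGases1994, §5.3 Step 14 (p. 160)] -/
def tensorNorm (κ : ℝ) (u : ℝ × E × E → ℝ) (y : (ℝ × E) × ((E × E) × sphere (0 : E) 1)) : ℝ :=
  (1 + κ * velMass u y.1)⁻¹ * (u (y.1.1, y.1.2, y.2.1.1) * u (y.1.1, y.1.2, y.2.1.2))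

/-- The post-collisional normalised tensor product
`G_κ(u) = u(t,x,ξ_*') u(t,x,ξ') / (1 + κ ∫ u dξ) = F_κ(u) ∘ (collision involution)` (CIP 1994
Step 14, p. 160: `fⁿ' fⁿ_*' / (1 + δ ∫ fⁿ dξ)`). [cite: CIPDiluteGases1994, §5.3 Step 14 (p. 160)] -/
def tensorNormColl (κ : ℝ) (u : ℝ × E × E → ℝ) (y : (ℝ × E) × ((E × E) × sphere (0 : E) 1)) : ℝ :=
  tensorNorm κ u (phaseCollideEquiv y)

/-- The ball `{|ξ|² + |ξ_*|² ≤ R²}` in the pair of velocities (invariant under the collision map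
and the exchange). [folklore] -/
def velBall (R : ℝ) : Set (E × E) := {v | ‖v.1‖ ^ 2 + ‖v.2‖ ^ 2 ≤ R ^ 2}

/-- The cut-off weights `w((t,x),((ξ,ξ_*),ω)) = 1_{|ξ|²+|ξ_*|² ≤ R²} · min(B(ξ,ξ_*,ω), M) · ρ(t,x)`.
[folklore] -/
def dissWeight (Bk : E × E → sphere (0 : E) 1 → ℝ) (ρ : ℝ × E → ℝ) (M R : ℝ)
    (y : (ℝ × E) × ((E × E) × sphere (0 : E) 1)) : ℝ :=
  (velBall R).indicator (fun _ => (1 : ℝ)) y.2.1 * (min (Bk y.2.1 y.2.2) M * ρ y.1)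

/-- The velocity average through which `w F_κ(u)` is tested:
`Ψ(t,x,ξ) = ρ(t,x) (1 + κ ∫ u dξ)⁻¹ ∫∫ 1_{|ξ|²+|ξ_*|² ≤ R²} min(B,M) θ u(t,x,ξ_*) dξ_* dω`. [folklore] -/
def dissTestAverage (Bk : E × E → sphere (0 : E) 1 → ℝ) (ρ : ℝ × E → ℝ) (M R κ : ℝ)
    (θ : (ℝ × E) × ((E × E) × sphere (0 : E) 1) → ℝ) (u : ℝ × E × E → ℝ) (z : ℝ × E × E) : ℝ :=
  ρ (z.1, z.2.1) * (1 + κ * velMass u (z.1, z.2.1))⁻¹ *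
    ∫ q : E × sphere (0 : E) 1, (velBall R).indicator (fun _ => (1 : ℝ)) (z.2.2, q.1) *
      min (Bk (z.2.2, q.1) q.2) M * θ ((z.1, z.2.1), ((z.2.2, q.1), q.2)) * u (z.1, z.2.1, q.1)
      ∂((volume : Measure E).prod (sphereMeasure (E := E)))

omit [InnerProductSpace ℝ E] [FiniteDimensional ℝ E] [MeasurableSpace E] [BorelSpace E] in
/-- `velBall` is symmetric under the exchange of the two velocities. [folklore] -/
theorem swap_mem_velBall {R : ℝ} {v : E × E} : v.swap ∈ velBall R ↔ v ∈ velBall (E := E) R := by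
  simp only [velBall, mem_setOf_eq, Prod.fst_swap, Prod.snd_swap]
  rw [add_comm]

omit [FiniteDimensional ℝ E] [MeasurableSpace E] [BorelSpace E] in
/-- `velBall` is invariant under the collision map (conservation of kinetic energy). [folklore] -/
theorem collide_mem_velBall {R : ℝ} (ω : sphere (0 : E) 1) {v : E × E} :
    collide ω v ∈ velBall R ↔ v ∈ velBall (E := E) R := by
  simp only [velBall, mem_setOf_eq, norm_sq_collide_fst_add_norm_sq_collide_snd]

/-- `velBall` is a closed, hence measurable, set. [folklore] -/
theorem measurableSet_velBall (R : ℝ) : MeasurableSet (velBall (E := E) R) := by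
  have : IsClosed (velBall (E := E) R) :=
    isClosed_le ((continuous_fst.norm.pow 2).add (continuous_snd.norm.pow 2)) continuous_const
  exact this.measurableSet

omit [InnerProductSpace ℝ E] [FiniteDimensional ℝ E] [MeasurableSpace E] [BorelSpace E] in
/-- Points of `velBall R` have both velocities of norm at most `|R|`. [folklore] -/
theorem norm_le_of_mem_velBall {R : ℝ} {v : E × E} (hv : v ∈ velBall R) :
    ‖v.1‖ ≤ |R| ∧ ‖v.2‖ ≤ |R| := by
  simp only [velBall, mem_setOf_eq] at hv
  have h1 : ‖v.1‖ ^ 2 ≤ R ^ 2 := by nlinarith [sq_nonneg ‖v.2‖]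
  have h2 : ‖v.2‖ ^ 2 ≤ R ^ 2 := by nlinarith [sq_nonneg ‖v.1‖]
  have h1' := sq_le_sq.1 h1
  have h2' := sq_le_sq.1 h2
  rw [abs_of_nonneg (norm_nonneg _)] at h1' h2'
  exact ⟨h1', h2'⟩

/-! ## Invariance of the weights under the collision involution; the symmetry identity -/

omit [FiniteDimensional ℝ E] [MeasurableSpace E] [BorelSpace E] in
/-- For a kernel with the two micro-reversibility symmetries, the cut-off weights are invariant
under the collision involution. [folklore] -/
theorem dissWeight_phaseCollide {Bk : E × E → sphere (0 : E) 1 → ℝ}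
    (hBc : ∀ p ω, Bk (collide ω p) (-ω) = Bk p ω) (hBs : ∀ p ω, Bk p.swap (-ω) = Bk p ω)
    (ρ : ℝ × E → ℝ) (M R : ℝ) (y : (ℝ × E) × ((E × E) × sphere (0 : E) 1)) :
    dissWeight Bk ρ M R (y.1, ((collide y.2.2 y.2.1).swap, y.2.2)) = dissWeight Bk ρ M R y := by
  simp only [dissWeight, kernel_collideSwap hBc hBs]
  congr 1
  by_cases h : y.2.1 ∈ velBall R
  · rw [indicator_of_mem h, indicator_of_mem (swap_mem_velBall.2 ((collide_mem_velBall _).2 h))]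
  · rw [indicator_of_notMem h, indicator_of_notMem
      (fun h' => h ((collide_mem_velBall _).1 (swap_mem_velBall.1 h')))]

/-- **Symmetry**: testing `w G_κ(u)` against `θ` is testing `w F_κ(u)` against `θ` composed with
the collision involution (measure preservation and `w ∘ σ = w`, `σ ∘ σ = id`; CIP 1994 §3.1
p. 35). [cite: CIPDiluteGases1994, §3.1 p. 35] -/
theorem integral_dissWeight_tensorNormColl_mul (T : ℝ) {Bk : E × E → sphere (0 : E) 1 → ℝ}
    (hBc : ∀ p ω, Bk (collide ω p) (-ω) = Bk p ω) (hBs : ∀ p ω, Bk p.swap (-ω) = Bk p ω)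
    (ρ : ℝ × E → ℝ) (M R κ : ℝ) (u : ℝ × E × E → ℝ)
    (θ : (ℝ × E) × ((E × E) × sphere (0 : E) 1) → ℝ) :
    ∫ y, dissWeight Bk ρ M R y * tensorNormColl κ u y * θ y ∂(dissPhaseMeasure E T) =
      ∫ y, dissWeight Bk ρ M R y * tensorNorm κ u y * θ (phaseCollideEquiv y)
        ∂(dissPhaseMeasure E T) := by
  have h := (measurePreserving_phaseCollideEquiv (E := E) T).integral_comp'
    (fun y => dissWeight Bk ρ M R y * tensorNorm κ u y * θ (phaseCollideEquiv y))
  rw [← h]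
  refine integral_congr_ae (ae_of_all _ fun y => ?_)
  simp only [phaseCollideEquiv_phaseCollideEquiv, tensorNormColl]
  rw [phaseCollideEquiv_apply y, dissWeight_phaseCollide hBc hBs]

/-! ## Tonelli/Fubini between the carrier and the slab -/

/-- Lower Lebesgue integrals over the slab in the grouping `(t,x)`, `ξ`. [folklore] -/
theorem lintegral_slab_eq_lintegral_lintegral {T : ℝ} {G : ℝ × E × E → ℝ≥0∞} (hG : Measurable G) :
    ∫⁻ z, G z ∂(slabMeasure E T) =
      ∫⁻ p : ℝ × E, (∫⁻ ξ : E, G (p.1, p.2, ξ)) ∂(baseSlabMeasure E T) := by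
  haveI : SigmaFinite (baseSlabMeasure E T) := by rw [baseSlabMeasure_def]; infer_instance
  have hmp := measurePreserving_slabAssoc (E := E) T
  rw [← hmp.lintegral_comp hG]
  exact lintegral_prod _ (hG.comp (slabAssoc (E := E)).measurable).aemeasurable

/-- Lower Lebesgue integrals over the carrier in the grouping `(t,x,ξ)`, `(ξ_*, ω)`. [folklore] -/
theorem lintegral_dissPhase_eq_lintegral_lintegral {T : ℝ}
    {H : (ℝ × E) × ((E × E) × sphere (0 : E) 1) → ℝ≥0∞} (hH : Measurable H) :
    ∫⁻ y, H y ∂(dissPhaseMeasure E T) =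
      ∫⁻ z : ℝ × E × E, ∫⁻ q : E × sphere (0 : E) 1, H ((z.1, z.2.1), ((z.2.2, q.1), q.2))
        ∂((volume : Measure E).prod (sphereMeasure (E := E))) ∂(slabMeasure E T) := by
  haveI := isFiniteMeasure_sphereMeasure (E := E)
  haveI : SigmaFinite (slabMeasure E T) := by rw [slabMeasure_def]; infer_instance
  have hmp := measurePreserving_dissPhaseEquiv (E := E) T
  rw [← hmp.lintegral_comp hH]
  exact lintegral_prod _ (hH.comp (dissPhaseEquiv (E := E)).measurable).aemeasurable

/-- Bochner integrals over the carrier in the grouping `(t,x,ξ)`, `(ξ_*, ω)`, for integrable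
integrands. [folklore] -/
theorem integral_dissPhase_eq_integral_integral {T : ℝ}
    {H : (ℝ × E) × ((E × E) × sphere (0 : E) 1) → ℝ} (hH : Integrable H (dissPhaseMeasure E T)) :
    ∫ y, H y ∂(dissPhaseMeasure E T) =
      ∫ z : ℝ × E × E, ∫ q : E × sphere (0 : E) 1, H ((z.1, z.2.1), ((z.2.2, q.1), q.2))
        ∂((volume : Measure E).prod (sphereMeasure (E := E))) ∂(slabMeasure E T) := by
  haveI := isFiniteMeasure_sphereMeasure (E := E)
  haveI : SigmaFinite (slabMeasure E T) := by rw [slabMeasure_def]; infer_instance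
  have hmp := measurePreserving_dissPhaseEquiv (E := E) T
  have hH' : Integrable (H ∘ dissPhaseEquiv) ((slabMeasure E T).prod
      ((volume : Measure E).prod (sphereMeasure (E := E)))) :=
    (hmp.integrable_comp_emb (dissPhaseEquiv (E := E)).measurableEmbedding).2 hH
  rw [← hmp.integral_comp' H]
  exact integral_prod _ hH'

/-! ## Measurability -/

/-- The velocity mass of a measurable density is measurable. [folklore] -/
theorem measurable_velMass {u : ℝ × E × E → ℝ} (hum : Measurable u) : Measurable (velMass u) := by
  unfold velMass
  exact (hum.comp (slabAssoc (E := E)).measurable).stronglyMeasurable.integral_prod_right'.measurable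

/-- The normalised tensor product of a measurable density is measurable. [folklore] -/
theorem measurable_tensorNorm (κ : ℝ) {u : ℝ × E × E → ℝ} (hum : Measurable u) :
    Measurable (tensorNorm κ u) := by
  unfold tensorNorm
  refine ((measurable_const.add (measurable_const.mul
    ((measurable_velMass hum).comp measurable_fst))).inv).mul ?_
  exact (hum.comp (measurable_fst.fst.prodMk (measurable_fst.snd.prodMk measurable_snd.fst.fst))).mul
    (hum.comp (measurable_fst.fst.prodMk (measurable_fst.snd.prodMk measurable_snd.fst.snd)))

/-- The post-collisional normalised tensor product of a measurable density is measurable.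
[folklore] -/
theorem measurable_tensorNormColl (κ : ℝ) {u : ℝ × E × E → ℝ} (hum : Measurable u) :
    Measurable (tensorNormColl κ u) :=
  (measurable_tensorNorm κ hum).comp (phaseCollideEquiv (E := E)).measurable

/-- The cut-off weights are measurable. [folklore] -/
theorem measurable_dissWeight {Bk : E × E → sphere (0 : E) 1 → ℝ}
    (hBm : Measurable (Function.uncurry Bk)) {ρ : ℝ × E → ℝ} (hρm : Measurable ρ) (M R : ℝ) :
    Measurable (dissWeight Bk ρ M R) := by
  unfold dissWeight
  refine ((measurable_const.indicator (measurableSet_velBall R)).comp measurable_snd.fst).mul ?_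
  exact ((hBm.comp (measurable_snd.fst.prodMk measurable_snd.snd)).min measurable_const).mul
    (hρm.comp measurable_fst)

omit [InnerProductSpace ℝ E] [FiniteDimensional ℝ E] [MeasurableSpace E] [BorelSpace E] in
/-- Bounds on the cut-off weights: `0 ≤ w ≤ M` when `B ≥ 0`, `M ≥ 0`, `0 ≤ ρ ≤ 1`. [folklore] -/
theorem dissWeight_nonneg_le {Bk : E × E → sphere (0 : E) 1 → ℝ} (hB0 : ∀ p ω, 0 ≤ Bk p ω)
    {ρ : ℝ × E → ℝ} (hρ0 : ∀ p, 0 ≤ ρ p) (hρ1 : ∀ p, ρ p ≤ 1) {M : ℝ} (hM : 0 ≤ M) (R : ℝ)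
    (y : (ℝ × E) × ((E × E) × sphere (0 : E) 1)) :
    0 ≤ dissWeight Bk ρ M R y ∧ dissWeight Bk ρ M R y ≤ M := by
  unfold dissWeight
  have h1 : 0 ≤ (velBall R).indicator (fun _ => (1 : ℝ)) y.2.1 ∧
      (velBall R).indicator (fun _ => (1 : ℝ)) y.2.1 ≤ 1 := by
    by_cases h : y.2.1 ∈ velBall R <;> simp [h]
  have h2 : 0 ≤ min (Bk y.2.1 y.2.2) M := le_min (hB0 _ _) hM
  have h3 : min (Bk y.2.1 y.2.2) M ≤ M := min_le_right _ _
  refine ⟨mul_nonneg h1.1 (mul_nonneg h2 (hρ0 _)), ?_⟩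
  calc (velBall R).indicator (fun _ => (1 : ℝ)) y.2.1 * (min (Bk y.2.1 y.2.2) M * ρ y.1)
      ≤ 1 * (M * 1) := mul_le_mul h1.2 (mul_le_mul h3 (hρ1 _) (hρ0 _) hM)
        (mul_nonneg h2 (hρ0 _)) zero_le_one
    _ = M := by ring

/-! ## Nonnegativity and the basic `L¹` bound of the normalised tensor product -/

/-- The velocity mass of a nonnegative density is nonnegative (junk value included). [folklore] -/
theorem velMass_nonneg {u : ℝ × E × E → ℝ} (hu0 : ∀ z, 0 ≤ u z) (p : ℝ × E) : 0 ≤ velMass u p :=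
  integral_nonneg fun _ => hu0 _

/-- The normalising factor `(1 + κ ∫ u dξ)⁻¹` lies in `[0, 1]` for `κ ≥ 0`, `u ≥ 0`. [folklore] -/
theorem normFactor_nonneg_le_one {κ : ℝ} (hκ : 0 ≤ κ) {u : ℝ × E × E → ℝ} (hu0 : ∀ z, 0 ≤ u z)
    (p : ℝ × E) : 0 ≤ (1 + κ * velMass u p)⁻¹ ∧ (1 + κ * velMass u p)⁻¹ ≤ 1 := by
  have h := mul_nonneg hκ (velMass_nonneg hu0 p)
  exact ⟨inv_nonneg.2 (by linarith), inv_le_one_of_one_le₀ (by linarith)⟩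

/-- `F_κ(u) ≥ 0` for `κ ≥ 0`, `u ≥ 0`. [folklore] -/
theorem tensorNorm_nonneg {κ : ℝ} (hκ : 0 ≤ κ) {u : ℝ × E × E → ℝ} (hu0 : ∀ z, 0 ≤ u z)
    (y : (ℝ × E) × ((E × E) × sphere (0 : E) 1)) : 0 ≤ tensorNorm κ u y :=
  mul_nonneg (normFactor_nonneg_le_one hκ hu0 _).1 (mul_nonneg (hu0 _) (hu0 _))

/-- `G_κ(u) ≥ 0` for `κ ≥ 0`, `u ≥ 0`. [folklore] -/
theorem tensorNormColl_nonneg {κ : ℝ} (hκ : 0 ≤ κ) {u : ℝ × E × E → ℝ} (hu0 : ∀ z, 0 ≤ u z)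
    (y : (ℝ × E) × ((E × E) × sphere (0 : E) 1)) : 0 ≤ tensorNormColl κ u y :=
  tensorNorm_nonneg hκ hu0 _

/-- The elementary inequality `(1 + κ r)⁻¹ r ≤ κ⁻¹` for `κ > 0`, `r ≥ 0`. [folklore] -/
theorem inv_one_add_mul_mul_le {κ r : ℝ} (hκ : 0 < κ) (hr : 0 ≤ r) :
    (1 + κ * r)⁻¹ * r ≤ κ⁻¹ := by
  have h1 : 0 < 1 + κ * r := by positivity
  rw [inv_mul_le_iff₀ h1]
  have hk : κ * κ⁻¹ = 1 := mul_inv_cancel₀ hκ.ne'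
  nlinarith [inv_pos.2 hκ]

/-- The elementary inequality `(1 + κ r)⁻¹ r² ≤ κ⁻¹ r` for `κ > 0`, `r ≥ 0`. [folklore] -/
theorem inv_one_add_mul_mul_mul_le {κ r : ℝ} (hκ : 0 < κ) (hr : 0 ≤ r) :
    (1 + κ * r)⁻¹ * r * r ≤ κ⁻¹ * r :=
  mul_le_mul_of_nonneg_right (inv_one_add_mul_mul_le hκ hr) hr

/-- **The basic bound**: `∫ F_κ(u) ≤ |S^{d-1}| κ⁻¹ ‖u‖_{L¹((0,T) × E × E)}` (lower Lebesgue integrals),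
since `∫∫ u(ξ) u(ξ_*) dξ dξ_* /(1 + κ ∫ u dξ) ≤ κ⁻¹ ∫ u dξ` pointwise in `(t, x)`. [folklore] -/
theorem lintegral_ofReal_tensorNorm_le {T κ : ℝ} (hκ : 0 < κ) {u : ℝ × E × E → ℝ}
    (hum : Measurable u) (hu0 : ∀ z, 0 ≤ u z) :
    ∫⁻ y, ENNReal.ofReal (tensorNorm κ u y) ∂(dissPhaseMeasure E T) ≤
      sphereMeasure (E := E) univ * ENNReal.ofReal κ⁻¹ *
        ∫⁻ z, ENNReal.ofReal (u z) ∂(slabMeasure E T) := by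
  haveI := isFiniteMeasure_sphereMeasure (E := E)
  set L : ℝ × E → ℝ≥0∞ := fun p => ∫⁻ ξ, ENNReal.ofReal (u (p.1, p.2, ξ)) with hL
  have hLm : Measurable L :=
    ((hum.comp (slabAssoc (E := E)).measurable).ennreal_ofReal.lintegral_prod_right'
      (ν := (volume : Measure E)) : _)
  have hmm : Measurable (velMass u) := measurable_velMass hum
  -- the inner integral over `(ξ_*, ω)`
  have hinner : ∀ z : ℝ × E × E,
      ∫⁻ q : E × sphere (0 : E) 1, ENNReal.ofReal (tensorNorm κ u ((z.1, z.2.1), ((z.2.2, q.1), q.2)))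
        ∂((volume : Measure E).prod (sphereMeasure (E := E))) =
      ENNReal.ofReal ((1 + κ * velMass u (z.1, z.2.1))⁻¹) * ENNReal.ofReal (u z) *
        (L (z.1, z.2.1) * sphereMeasure (E := E) univ) := by
    intro z
    have hc := (normFactor_nonneg_le_one hκ.le hu0 (z.1, z.2.1)).1
    have heq : ∀ q : E × sphere (0 : E) 1,
        ENNReal.ofReal (tensorNorm κ u ((z.1, z.2.1), ((z.2.2, q.1), q.2))) =
        ENNReal.ofReal ((1 + κ * velMass u (z.1, z.2.1))⁻¹) * ENNReal.ofReal (u z) *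
          (ENNReal.ofReal (u (z.1, z.2.1, q.1)) * 1) := by
      intro q
      simp only [tensorNorm, mul_one]
      rw [ENNReal.ofReal_mul hc, ENNReal.ofReal_mul (hu0 _), mul_assoc]
    simp only [heq]
    have hmeasξ : Measurable (fun ξ : E => ENNReal.ofReal (u (z.1, z.2.1, ξ))) :=
      (hum.comp (measurable_const.prodMk (measurable_const.prodMk measurable_id))).ennreal_ofReal
    have hprod : ∫⁻ q : E × sphere (0 : E) 1, ENNReal.ofReal (u (z.1, z.2.1, q.1)) * 1
        ∂((volume : Measure E).prod (sphereMeasure (E := E))) =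
        L (z.1, z.2.1) * sphereMeasure (E := E) univ := by
      have h := lintegral_prod_mul (μ := (volume : Measure E)) (ν := sphereMeasure (E := E))
        (f := fun ξ : E => ENNReal.ofReal (u (z.1, z.2.1, ξ))) (g := fun _ => (1 : ℝ≥0∞))
        hmeasξ.aemeasurable aemeasurable_const
      simpa [lintegral_one] using h
    rw [lintegral_const_mul' _ _ (ENNReal.mul_ne_top ENNReal.ofReal_ne_top ENNReal.ofReal_ne_top),
      hprod]
  -- the pointwise bound in `(t, x)`
  have hpt : ∀ p : ℝ × E,
      ENNReal.ofReal ((1 + κ * velMass u p)⁻¹) * L p * L p ≤ ENNReal.ofReal κ⁻¹ * L p := by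
    intro p
    by_cases htop : L p = ∞
    · calc _ ≤ (⊤ : ℝ≥0∞) := le_top
        _ = ENNReal.ofReal κ⁻¹ * L p := by
            rw [htop, ENNReal.mul_top (ne_of_gt (ENNReal.ofReal_pos.2 (inv_pos.2 hκ)))]
    · have hint : Integrable (fun ξ => u (p.1, p.2, ξ)) (volume : Measure E) := by
        refine ⟨(hum.comp (measurable_const.prodMk (measurable_const.prodMk
          measurable_id))).aestronglyMeasurable, ?_⟩
        rw [HasFiniteIntegral]
        calc ∫⁻ ξ, ‖u (p.1, p.2, ξ)‖ₑ = L p := lintegral_congr fun ξ => Real.enorm_eq_ofReal (hu0 _)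
          _ < ⊤ := lt_top_iff_ne_top.2 htop
      have hLr : L p = ENNReal.ofReal (velMass u p) := by
        simp only [hL, velMass]
        rw [ofReal_integral_eq_lintegral_ofReal hint (ae_of_all _ fun ξ => hu0 _)]
      have hr := velMass_nonneg hu0 p
      rw [hLr, ← ENNReal.ofReal_mul (normFactor_nonneg_le_one hκ.le hu0 p).1,
        ← ENNReal.ofReal_mul (mul_nonneg (normFactor_nonneg_le_one hκ.le hu0 p).1 hr),
        ← ENNReal.ofReal_mul (inv_nonneg.2 hκ.le)]
      exact ENNReal.ofReal_le_ofReal (inv_one_add_mul_mul_mul_le hκ hr)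
  -- assemble
  rw [lintegral_dissPhase_eq_lintegral_lintegral (measurable_tensorNorm κ hum).ennreal_ofReal]
  simp only [hinner]
  rw [lintegral_slab_eq_lintegral_lintegral, lintegral_slab_eq_lintegral_lintegral
    hum.ennreal_ofReal]
  rotate_left
  · exact (((hmm.comp (measurable_fst.prodMk measurable_snd.fst)).const_mul κ |>.const_add 1).inv.ennreal_ofReal.mul
      hum.ennreal_ofReal).mul ((hLm.comp (measurable_fst.prodMk measurable_snd.fst)).mul_const _)
  calc ∫⁻ p : ℝ × E, (∫⁻ ξ : E, ENNReal.ofReal ((1 + κ * velMass u ((p.1, p.2, ξ).1, (p.1, p.2, ξ).2.1))⁻¹) *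
          ENNReal.ofReal (u (p.1, p.2, ξ)) *
          (L ((p.1, p.2, ξ).1, (p.1, p.2, ξ).2.1) * sphereMeasure (E := E) univ)) ∂(baseSlabMeasure E T)
      = ∫⁻ p : ℝ × E, sphereMeasure (E := E) univ *
          (ENNReal.ofReal ((1 + κ * velMass u p)⁻¹) * L p * L p) ∂(baseSlabMeasure E T) := by
        refine lintegral_congr fun p => ?_
        simp only [Prod.mk.eta]
        have hmeasξ : Measurable (fun ξ : E => ENNReal.ofReal (u (p.1, p.2, ξ))) :=
          (hum.comp (measurable_const.prodMk (measurable_const.prodMk measurable_id))).ennreal_ofReal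
        have h1 : ∫⁻ ξ : E, (sphereMeasure (E := E) univ * ENNReal.ofReal ((1 + κ * velMass u p)⁻¹) * L p) *
            ENNReal.ofReal (u (p.1, p.2, ξ)) =
            (sphereMeasure (E := E) univ * ENNReal.ofReal ((1 + κ * velMass u p)⁻¹) * L p) *
              ∫⁻ ξ : E, ENNReal.ofReal (u (p.1, p.2, ξ)) := lintegral_const_mul _ hmeasξ
        have : (fun ξ : E => ENNReal.ofReal ((1 + κ * velMass u p)⁻¹) * ENNReal.ofReal (u (p.1, p.2, ξ)) *
            (L p * sphereMeasure (E := E) univ)) =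
            fun ξ => (sphereMeasure (E := E) univ * ENNReal.ofReal ((1 + κ * velMass u p)⁻¹) * L p) *
              ENNReal.ofReal (u (p.1, p.2, ξ)) := funext fun ξ => by ring
        rw [this, h1]
        ring
    _ ≤ ∫⁻ p : ℝ × E, sphereMeasure (E := E) univ * (ENNReal.ofReal κ⁻¹ * L p)
          ∂(baseSlabMeasure E T) := lintegral_mono fun p => mul_le_mul' le_rfl (hpt p)
    _ = sphereMeasure (E := E) univ * ENNReal.ofReal κ⁻¹ * ∫⁻ p : ℝ × E, L p ∂(baseSlabMeasure E T) := by
        rw [lintegral_const_mul _ (hLm.const_mul _), lintegral_const_mul _ hLm, mul_assoc]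

/-- The post-collisional tensor product has the same integral as the pre-collisional one.
[folklore] -/
theorem lintegral_ofReal_tensorNormColl_eq (T κ : ℝ) {u : ℝ × E × E → ℝ} (hum : Measurable u) :
    ∫⁻ y, ENNReal.ofReal (tensorNormColl κ u y) ∂(dissPhaseMeasure E T) =
      ∫⁻ y, ENNReal.ofReal (tensorNorm κ u y) ∂(dissPhaseMeasure E T) :=
  (measurePreserving_phaseCollideEquiv (E := E) T).lintegral_comp
    (measurable_tensorNorm κ hum).ennreal_ofReal

/-! ## Integrability of the weighted products -/

/-- `w F_κ(u) θ ∈ L¹` of the carrier for bounded `θ`, `B ≥ 0`, `0 ≤ ρ ≤ 1`, `M ≥ 0`, `κ > 0` and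
`0 ≤ u ∈ L¹((0,T) × E × E)`. [folklore] -/
theorem integrable_dissWeight_tensorNorm_mul {T : ℝ} {Bk : E × E → sphere (0 : E) 1 → ℝ}
    (hBm : Measurable (Function.uncurry Bk)) (hB0 : ∀ p ω, 0 ≤ Bk p ω)
    {ρ : ℝ × E → ℝ} (hρm : Measurable ρ) (hρ0 : ∀ p, 0 ≤ ρ p) (hρ1 : ∀ p, ρ p ≤ 1)
    {M R κ : ℝ} (hM : 0 ≤ M) (hκ : 0 < κ)
    {θ : (ℝ × E) × ((E × E) × sphere (0 : E) 1) → ℝ} (hθm : Measurable θ) {C : ℝ} (hC0 : 0 ≤ C)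
    (hθC : ∀ y, |θ y| ≤ C) {u : ℝ × E × E → ℝ} (hum : Measurable u) (hu0 : ∀ z, 0 ≤ u z)
    (hui : Integrable u (slabMeasure E T)) :
    Integrable (fun y => dissWeight Bk ρ M R y * tensorNorm κ u y * θ y) (dissPhaseMeasure E T) := by
  haveI := isFiniteMeasure_sphereMeasure (E := E)
  refine ⟨(((measurable_dissWeight hBm hρm M R).mul (measurable_tensorNorm κ hum)).mul
    hθm).aestronglyMeasurable, ?_⟩
  have hpt : ∀ y, ‖dissWeight Bk ρ M R y * tensorNorm κ u y * θ y‖ₑ ≤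
      ENNReal.ofReal (M * C) * ENNReal.ofReal (tensorNorm κ u y) := by
    intro y
    obtain ⟨hw0, hwM⟩ := dissWeight_nonneg_le hB0 hρ0 hρ1 hM R y
    have hF0 := tensorNorm_nonneg hκ.le hu0 y
    rw [Real.enorm_eq_ofReal_abs, ← ENNReal.ofReal_mul (mul_nonneg hM hC0)]
    refine ENNReal.ofReal_le_ofReal ?_
    rw [abs_mul, abs_mul, abs_of_nonneg hw0, abs_of_nonneg hF0]
    calc dissWeight Bk ρ M R y * tensorNorm κ u y * |θ y| ≤ M * tensorNorm κ u y * C :=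
          mul_le_mul (mul_le_mul_of_nonneg_right hwM hF0) (hθC y) (abs_nonneg _)
            (mul_nonneg hM hF0)
      _ = M * C * tensorNorm κ u y := by ring
  refine lt_of_le_of_lt (lintegral_mono hpt) ?_
  rw [lintegral_const_mul' _ _ ENNReal.ofReal_ne_top]
  refine ENNReal.mul_lt_top ENNReal.ofReal_lt_top ?_
  refine lt_of_le_of_lt (lintegral_ofReal_tensorNorm_le hκ hum hu0) ?_
  refine ENNReal.mul_lt_top (ENNReal.mul_lt_top (measure_lt_top _ _) ENNReal.ofReal_lt_top) ?_
  have := hui.2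
  rw [HasFiniteIntegral] at this
  calc ∫⁻ z, ENNReal.ofReal (u z) ∂(slabMeasure E T) = ∫⁻ z, ‖u z‖ₑ ∂(slabMeasure E T) :=
        lintegral_congr fun z => (Real.enorm_eq_ofReal (hu0 z)).symm
    _ < ⊤ := this

/-- `w G_κ(u) θ ∈ L¹` of the carrier, under the same hypotheses. [folklore] -/
theorem integrable_dissWeight_tensorNormColl_mul {T : ℝ} {Bk : E × E → sphere (0 : E) 1 → ℝ}
    (hBm : Measurable (Function.uncurry Bk)) (hB0 : ∀ p ω, 0 ≤ Bk p ω)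
    {ρ : ℝ × E → ℝ} (hρm : Measurable ρ) (hρ0 : ∀ p, 0 ≤ ρ p) (hρ1 : ∀ p, ρ p ≤ 1)
    {M R κ : ℝ} (hM : 0 ≤ M) (hκ : 0 < κ)
    {θ : (ℝ × E) × ((E × E) × sphere (0 : E) 1) → ℝ} (hθm : Measurable θ) {C : ℝ} (hC0 : 0 ≤ C)
    (hθC : ∀ y, |θ y| ≤ C) {u : ℝ × E × E → ℝ} (hum : Measurable u) (hu0 : ∀ z, 0 ≤ u z)
    (hui : Integrable u (slabMeasure E T)) :
    Integrable (fun y => dissWeight Bk ρ M R y * tensorNormColl κ u y * θ y)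
      (dissPhaseMeasure E T) := by
  haveI := isFiniteMeasure_sphereMeasure (E := E)
  refine ⟨(((measurable_dissWeight hBm hρm M R).mul (measurable_tensorNormColl κ hum)).mul
    hθm).aestronglyMeasurable, ?_⟩
  have hpt : ∀ y, ‖dissWeight Bk ρ M R y * tensorNormColl κ u y * θ y‖ₑ ≤
      ENNReal.ofReal (M * C) * ENNReal.ofReal (tensorNormColl κ u y) := by
    intro y
    obtain ⟨hw0, hwM⟩ := dissWeight_nonneg_le hB0 hρ0 hρ1 hM R y
    have hF0 := tensorNormColl_nonneg hκ.le hu0 y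
    rw [Real.enorm_eq_ofReal_abs, ← ENNReal.ofReal_mul (mul_nonneg hM hC0)]
    refine ENNReal.ofReal_le_ofReal ?_
    rw [abs_mul, abs_mul, abs_of_nonneg hw0, abs_of_nonneg hF0]
    calc dissWeight Bk ρ M R y * tensorNormColl κ u y * |θ y| ≤ M * tensorNormColl κ u y * C :=
          mul_le_mul (mul_le_mul_of_nonneg_right hwM hF0) (hθC y) (abs_nonneg _)
            (mul_nonneg hM hF0)
      _ = M * C * tensorNormColl κ u y := by ring
  refine lt_of_le_of_lt (lintegral_mono hpt) ?_
  rw [lintegral_const_mul' _ _ ENNReal.ofReal_ne_top, lintegral_ofReal_tensorNormColl_eq T κ hum]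
  refine ENNReal.mul_lt_top ENNReal.ofReal_lt_top ?_
  refine lt_of_le_of_lt (lintegral_ofReal_tensorNorm_le hκ hum hu0) ?_
  refine ENNReal.mul_lt_top (ENNReal.mul_lt_top (measure_lt_top _ _) ENNReal.ofReal_lt_top) ?_
  have := hui.2
  rw [HasFiniteIntegral] at this
  calc ∫⁻ z, ENNReal.ofReal (u z) ∂(slabMeasure E T) = ∫⁻ z, ‖u z‖ₑ ∂(slabMeasure E T) :=
        lintegral_congr fun z => (Real.enorm_eq_ofReal (hu0 z)).symm
    _ < ⊤ := this

/-! ## The Fubini identity: testing `w F_κ(u)` is testing `u` against a velocity average -/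

/-- **Fubini**: `∫ w F_κ(u) θ = ∫_{(0,T)×E×E} u Ψ` with
`Ψ(t,x,ξ) = ρ (1 + κ ∫u dξ)⁻¹ ∫∫ 1_{|ξ|²+|ξ_*|² ≤ R²} min(B,M) θ u(ξ_*) dξ_* dω` (`dissTestAverage`).
[folklore] -/
theorem integral_dissWeight_tensorNorm_mul {T : ℝ} (Bk : E × E → sphere (0 : E) 1 → ℝ)
    (ρ : ℝ × E → ℝ) (M R κ : ℝ) (θ : (ℝ × E) × ((E × E) × sphere (0 : E) 1) → ℝ)
    (u : ℝ × E × E → ℝ)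
    (hint : Integrable (fun y => dissWeight Bk ρ M R y * tensorNorm κ u y * θ y)
      (dissPhaseMeasure E T)) :
    ∫ y, dissWeight Bk ρ M R y * tensorNorm κ u y * θ y ∂(dissPhaseMeasure E T) =
      ∫ z, u z * dissTestAverage Bk ρ M R κ θ u z ∂(slabMeasure E T) := by
  rw [integral_dissPhase_eq_integral_integral hint]
  refine integral_congr_ae (ae_of_all _ fun z => ?_)
  beta_reduce
  unfold dissTestAverage
  rw [← integral_const_mul (L := ℝ), ← integral_const_mul (L := ℝ)]
  refine integral_congr_ae (ae_of_all _ fun q => ?_)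
  simp only [dissWeight, tensorNorm, Prod.mk.eta]
  ring

/-- The velocity average `Ψ` is measurable, for measurable data. [folklore] -/
theorem measurable_dissTestAverage {Bk : E × E → sphere (0 : E) 1 → ℝ}
    (hBm : Measurable (Function.uncurry Bk)) {ρ : ℝ × E → ℝ} (hρm : Measurable ρ) (M R κ : ℝ)
    {θ : (ℝ × E) × ((E × E) × sphere (0 : E) 1) → ℝ} (hθm : Measurable θ)
    {u : ℝ × E × E → ℝ} (hum : Measurable u) :
    Measurable (dissTestAverage Bk ρ M R κ θ u) := by
  haveI := isFiniteMeasure_sphereMeasure (E := E)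
  unfold dissTestAverage
  have htx : Measurable fun z : ℝ × E × E => (z.1, z.2.1) := measurable_fst.prodMk measurable_snd.fst
  refine ((hρm.comp htx).mul ((measurable_const.add (measurable_const.mul
    ((measurable_velMass hum).comp htx))).inv)).mul ?_
  -- the parametric integral
  have hK : Measurable fun y : (ℝ × E × E) × (E × sphere (0 : E) 1) =>
      (velBall R).indicator (fun _ => (1 : ℝ)) (y.1.2.2, y.2.1) *
        min (Bk (y.1.2.2, y.2.1) y.2.2) M * θ ((y.1.1, y.1.2.1), ((y.1.2.2, y.2.1), y.2.2)) *
        u (y.1.1, y.1.2.1, y.2.1) := by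
    have hv : Measurable fun y : (ℝ × E × E) × (E × sphere (0 : E) 1) => (y.1.2.2, y.2.1) :=
      measurable_fst.snd.snd.prodMk measurable_snd.fst
    refine ((((measurable_const.indicator (measurableSet_velBall R)).comp hv).mul
      ((hBm.comp (hv.prodMk measurable_snd.snd)).min measurable_const)).mul
      (hθm.comp (dissPhaseEquiv (E := E)).measurable)).mul ?_
    exact hum.comp (measurable_fst.fst.prodMk (measurable_fst.snd.fst.prodMk measurable_snd.fst))
  exact hK.stronglyMeasurable.integral_prod_right'.measurable

/-- **`Ψ` is essentially bounded**: `|Ψ| ≤ M C |S^{d-1}| κ⁻¹` almost everywhere on the slab, for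
`|θ| ≤ C`, `B ≥ 0`, `0 ≤ ρ ≤ 1`, `M ≥ 0`, `κ > 0`, `0 ≤ u ∈ L¹` (at every point whose velocity
section of `u` is integrable, `∫∫ min(B,M) |θ| u(ξ_*) ≤ M C |S^{d-1}| ∫ u dξ`). [folklore] -/
theorem ae_abs_dissTestAverage_le {T : ℝ} {Bk : E × E → sphere (0 : E) 1 → ℝ}
    (hB0 : ∀ p ω, 0 ≤ Bk p ω)
    {ρ : ℝ × E → ℝ} (hρ0 : ∀ p, 0 ≤ ρ p) (hρ1 : ∀ p, ρ p ≤ 1)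
    {M R κ : ℝ} (hM : 0 ≤ M) (hκ : 0 < κ)
    {θ : (ℝ × E) × ((E × E) × sphere (0 : E) 1) → ℝ} {C : ℝ} (hC0 : 0 ≤ C)
    (hθC : ∀ y, |θ y| ≤ C) {u : ℝ × E × E → ℝ} (hu0 : ∀ z, 0 ≤ u z)
    (hui : Integrable u (slabMeasure E T)) :
    ∀ᵐ z ∂(slabMeasure E T), |dissTestAverage Bk ρ M R κ θ u z| ≤
      M * C * (sphereMeasure (E := E) univ).toReal * κ⁻¹ := by
  haveI := isFiniteMeasure_sphereMeasure (E := E)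
  have hsec := ae_comp_base (ae_integrable_velocity_section hui) (E := E)
  filter_upwards [hsec] with z hz
  -- the section `ξ_* ↦ u(t, x, ξ_*)` is integrable at this point
  set m : ℝ := velMass u (z.1, z.2.1) with hm
  have hm0 : 0 ≤ m := velMass_nonneg hu0 _
  have hc := normFactor_nonneg_le_one hκ.le hu0 (z.1, z.2.1)
  -- bound of the inner integral
  set K : E × sphere (0 : E) 1 → ℝ := fun q => (velBall R).indicator (fun _ => (1 : ℝ)) (z.2.2, q.1) *
    min (Bk (z.2.2, q.1) q.2) M * θ ((z.1, z.2.1), ((z.2.2, q.1), q.2)) * u (z.1, z.2.1, q.1) with hKdef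
  have hKle : ∀ q, |K q| ≤ M * C * u (z.1, z.2.1, q.1) := by
    intro q
    have h1 : |(velBall R).indicator (fun _ => (1 : ℝ)) (z.2.2, q.1)| ≤ 1 := by
      by_cases h : (z.2.2, q.1) ∈ velBall R <;> simp [h]
    have h2 : |min (Bk (z.2.2, q.1) q.2) M| ≤ M := by
      rw [abs_of_nonneg (le_min (hB0 _ _) hM)]; exact min_le_right _ _
    simp only [hKdef, abs_mul, abs_of_nonneg (hu0 _)]
    calc |(velBall R).indicator (fun _ => (1 : ℝ)) (z.2.2, q.1)| * |min (Bk (z.2.2, q.1) q.2) M| *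
          |θ ((z.1, z.2.1), ((z.2.2, q.1), q.2))| * u (z.1, z.2.1, q.1)
        ≤ 1 * M * C * u (z.1, z.2.1, q.1) :=
          mul_le_mul_of_nonneg_right (mul_le_mul (mul_le_mul h1 h2 (abs_nonneg _) zero_le_one)
            (hθC _) (abs_nonneg _) (mul_nonneg zero_le_one hM)) (hu0 _)
      _ = M * C * u (z.1, z.2.1, q.1) := by ring
  have hdom : Integrable (fun q : E × sphere (0 : E) 1 => M * C * u (z.1, z.2.1, q.1))
      ((volume : Measure E).prod (sphereMeasure (E := E))) :=
    (hz.const_mul (M * C)).comp_fst (sphereMeasure (E := E))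
  have hIle : |∫ q, K q ∂((volume : Measure E).prod (sphereMeasure (E := E)))| ≤
      M * C * (sphereMeasure (E := E) univ).toReal * m := by
    calc |∫ q, K q ∂((volume : Measure E).prod (sphereMeasure (E := E)))|
        ≤ ∫ q, M * C * u (z.1, z.2.1, q.1) ∂((volume : Measure E).prod (sphereMeasure (E := E))) := by
          refine (abs_integral_le_integral_abs).trans ?_
          exact integral_mono_of_nonneg (ae_of_all _ fun q => abs_nonneg _) hdom
            (ae_of_all _ hKle)
      _ = M * C * (sphereMeasure (E := E) univ).toReal * m := by
          rw [integral_fun_fst (fun ξ : E => M * C * u (z.1, z.2.1, ξ)), integral_const_mul,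
            measureReal_def, smul_eq_mul, hm, velMass]
          ring
  have hcm : (1 + κ * m)⁻¹ * m ≤ κ⁻¹ := inv_one_add_mul_mul_le hκ hm0
  have hpos : 0 ≤ M * C * (sphereMeasure (E := E) univ).toReal := by positivity
  change |ρ (z.1, z.2.1) * (1 + κ * velMass u (z.1, z.2.1))⁻¹ *
    ∫ q, K q ∂((volume : Measure E).prod (sphereMeasure (E := E)))| ≤ _
  rw [← hm, abs_mul, abs_mul, abs_of_nonneg (hρ0 _), abs_of_nonneg hc.1]
  calc ρ (z.1, z.2.1) * (1 + κ * m)⁻¹ * |∫ q, K q ∂((volume : Measure E).prod (sphereMeasure (E := E)))|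
      ≤ 1 * (1 + κ * m)⁻¹ * (M * C * (sphereMeasure (E := E) univ).toReal * m) :=
        mul_le_mul (mul_le_mul_of_nonneg_right (hρ1 _) hc.1) hIle (abs_nonneg _)
          (mul_nonneg zero_le_one hc.1)
    _ = M * C * (sphereMeasure (E := E) univ).toReal * ((1 + κ * m)⁻¹ * m) := by ring
    _ ≤ M * C * (sphereMeasure (E := E) univ).toReal * κ⁻¹ := mul_le_mul_of_nonneg_left hcm hpos

end Carrier

end Literature.MathematicalPhysics.KineticTheory
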